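import Mathlib
import HarnessLib

/-!
# Stub `stub_cycloGlue` (line `Sketch` = `kurihara-fourier-support`, crux `PlecticLegs.TwistSupply`)

Pure Galois theory of the cyclotomic field `ℚ(ζ_m)`: an even Dirichlet character `χ mod m`
cuts out, as the fixed field of `H = ker χ ≤ Gal(ℚ(ζ_m)/ℚ) ≃ (ℤ/m)ˣ`, a totally real field of
degree `ord χ` whose characters (the characters mod `m` trivial on `H`, phrased through the
action of `H` on the `m`-th roots of unity) are exactly the powers of `χ`.

The proof uses Mathlib's duality between subgroups of `Gal(ℚ(ζ_m)/ℚ)` and subgroups of the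
group of Dirichlet characters mod `m` (`IsCyclotomicExtension.Rat.subgroupGalEquivSubgroupChar`):
`H` is the subgroup dual to `⟨χ⟩`.  Total reality: every complex conjugation of `ℚ(ζ_m)` acts on
roots of unity by inversion, hence corresponds to `-1 ∈ (ℤ/m)ˣ`, which lies in `ker χ` because
`χ` is even.
-/

noncomputable section

set_option linter.dupNamespace false

namespace Summit.BirchSwinnertonDyer.BirchSwinnertonDyer.Theorems

open IsCyclotomicExtension NumberField

/-- In an `m`-th cyclotomic extension `K/ℚ`, an automorphism `σ` which is the complex
conjugation for some complex embedding `φ : K →+* ℂ` corresponds to `-1 ∈ (ℤ/m)ˣ` under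
`Gal(K/ℚ) ≃* (ℤ/m)ˣ`. -/
theorem cycloGlue_galEquivZMod_eq_neg_one_of_isConj {m : ℕ} [NeZero m]
    {K : Type*} [Field K] [NumberField K] [IsCyclotomicExtension {m} ℚ K]
    (φ : K →+* ℂ) (σ : Gal(K/ℚ)) (hσ : ComplexEmbedding.IsConj φ σ) :
    ((Rat.galEquivZMod m K σ : (ZMod m)ˣ) : ZMod m) = -1 := by
  have hζ := zeta_spec m ℚ K
  have h1 : σ (zeta m ℚ K) =
      zeta m ℚ K ^ ((Rat.galEquivZMod m K σ : (ZMod m)ˣ) : ZMod m).val :=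
    Rat.galEquivZMod_apply_of_pow_eq m K σ hζ.pow_eq_one
  have h2 : φ (σ (zeta m ℚ K)) = (φ (zeta m ℚ K))⁻¹ := by
    rw [hσ.eq, ← starRingEnd_apply, ← Complex.inv_eq_conj]
    exact Complex.norm_eq_one_of_pow_eq_one (by rw [← map_pow, hζ.pow_eq_one, map_one])
      (NeZero.ne m)
  have h3 : σ (zeta m ℚ K) = (zeta m ℚ K)⁻¹ := φ.injective (by rw [h2, map_inv₀])
  have h4 : zeta m ℚ K ^ (((Rat.galEquivZMod m K σ : (ZMod m)ˣ) : ZMod m).val + 1) = 1 := by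
    rw [pow_succ, ← h1, h3, inv_mul_cancel₀ (hζ.ne_zero (NeZero.ne m))]
  have h5 : (m : ℕ) ∣ ((Rat.galEquivZMod m K σ : (ZMod m)ˣ) : ZMod m).val + 1 :=
    (hζ.pow_eq_one_iff_dvd _).mp h4
  have h6 : ((((Rat.galEquivZMod m K σ : (ZMod m)ˣ) : ZMod m).val + 1 : ℕ) : ZMod m) = 0 :=
    (ZMod.natCast_eq_zero_iff _ _).mpr h5
  rw [Nat.cast_add, Nat.cast_one, ZMod.natCast_zmod_val] at h6
  exact eq_neg_of_add_eq_zero_left h6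

/-- The cyclotomic glue for an arbitrary `m`-th cyclotomic extension `K/ℚ`: an even Dirichlet
character `χ mod m` gives a subgroup `H ≤ Gal(K/ℚ)` (the dual of `⟨χ⟩`) whose fixed field is
totally real of degree `orderOf χ`, and every character mod `m` trivial on `H` (phrased through
the action of `H` on `m`-th roots of unity) is a power of `χ`. -/
theorem cycloGlue_of_isCyclotomicExtension {m : ℕ} [NeZero m]
    (K : Type*) [Field K] [NumberField K] [IsCyclotomicExtension {m} ℚ K]
    (χ : DirichletCharacter ℂ m) (hχ : χ.Even) :
    ∃ H : Subgroup Gal(K/ℚ),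
      NumberField.IsTotallyReal ↥(IntermediateField.fixedField H) ∧
      Module.finrank ℚ ↥(IntermediateField.fixedField H) = orderOf χ ∧
      ∀ χ' : DirichletCharacter ℂ m,
        (∀ σ ∈ H, ∀ a : ℕ, (∀ z : K, z ^ m = 1 → σ z = z ^ a) → χ' (a : ZMod m) = 1) →
          ∃ j : ℕ, χ' = χ ^ j := by
  haveI : IsGalois ℚ K := IsCyclotomicExtension.isGalois {m} ℚ K
  haveI : IsMulCommutative Gal(K/ℚ) := IsCyclotomicExtension.isMulCommutative {m} ℚ K
  obtain ⟨H, hHmem, hΦH⟩ : ∃ H : Subgroup Gal(K/ℚ),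
      (∀ σ, σ ∈ H ↔ χ (Rat.galEquivZMod m K σ) = 1) ∧
      OrderDual.ofDual (Rat.subgroupGalEquivSubgroupChar m K ℂ H) = Subgroup.zpowers χ := by
    refine ⟨(Rat.subgroupGalEquivSubgroupChar m K ℂ).symm (OrderDual.toDual (Subgroup.zpowers χ)),
      fun σ ↦ ?_, ?_⟩
    · rw [Rat.mem_subgroupGalEquivSubgroupChar_symm_iff]
      refine ⟨fun h ↦ h χ (Subgroup.mem_zpowers χ), fun h χ'' hχ'' ↦ ?_⟩
      obtain ⟨k, rfl⟩ := (Submonoid.mem_powers_iff _ _).mp (mem_powers_iff_mem_zpowers.mpr hχ'')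
      rw [MulChar.pow_apply_coe, h, one_pow]
    · rw [OrderIso.apply_symm_apply, OrderDual.ofDual_toDual]
  refine ⟨H, ⟨fun w ↦ ?_⟩, ?_, fun χ' hχ' ↦ ?_⟩
  · -- total reality: every complex conjugation lies in `H`
    rw [InfinitePlace.isReal_iff, ComplexEmbedding.isReal_iff]
    ext1 x
    rw [ComplexEmbedding.conjugate_coe_eq,
      ← ComplexEmbedding.lift_algebraMap_apply K w.embedding x]
    obtain ⟨σ, hσ⟩ := ComplexEmbedding.exists_comp_symm_eq_of_comp_eq (k := ℚ)
      (ComplexEmbedding.lift K w.embedding)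
      (ComplexEmbedding.conjugate (ComplexEmbedding.lift K w.embedding)) (Subsingleton.elim _ _)
    have hconj : ComplexEmbedding.IsConj (ComplexEmbedding.lift K w.embedding) σ.symm := hσ.symm
    have hσH : σ.symm ∈ H := by
      rw [hHmem, cycloGlue_galEquivZMod_eq_neg_one_of_isConj _ _ hconj]
      exact hχ
    rw [starRingEnd_apply, ← hconj.eq]
    exact congrArg (ComplexEmbedding.lift K w.embedding)
      ((IntermediateField.mem_fixedField_iff H _).mp x.2 _ hσH)
  · -- degree
    rw [IntermediateField.finrank_eq_fixingSubgroup_index,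
      IntermediateField.fixingSubgroup_fixedField, Subgroup.index_eq_card,
      ← Rat.card_subgroupGalEquivSubgroupChar m K ℂ H, hΦH, Nat.card_zpowers]
  · -- characters trivial on `H` are powers of `χ`
    have hmem : χ' ∈ OrderDual.ofDual (Rat.subgroupGalEquivSubgroupChar m K ℂ H) := by
      rw [Rat.mem_subgroupGalEquivSubgroupChar_iff]
      intro σ hσ
      have := hχ' σ hσ ((Rat.galEquivZMod m K σ : (ZMod m)ˣ) : ZMod m).val
        (fun z hz ↦ Rat.galEquivZMod_apply_of_pow_eq m K σ hz)
      rwa [ZMod.natCast_zmod_val] at this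
    rw [hΦH] at hmem
    obtain ⟨j, hj⟩ := (Submonoid.mem_powers_iff _ _).mp (mem_powers_iff_mem_zpowers.mpr hmem)
    exact ⟨j, hj.symm⟩

/-- **Cyclotomic glue** (registered stub `stub_cycloGlue` of line `Sketch`): an even Dirichlet
character `χ mod m` cuts out, as the fixed field of a subgroup `H ≤ Gal(ℚ(ζ_m)/ℚ)`
(namely `H = ker χ` under `Gal(ℚ(ζ_m)/ℚ) ≃ (ℤ/m)ˣ`), a totally real field of degree `ord χ`
such that every Dirichlet character mod `m` trivial on `H` (in the `μ_m`-phrasing of the crux)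
is a power of `χ`. -/
theorem stub_cycloGlue :
    ∀ (m : ℕ) [NeZero m] (χ : DirichletCharacter ℂ m), χ.Even →
      ∃ H : Subgroup (CyclotomicField m ℚ ≃ₐ[ℚ] CyclotomicField m ℚ),
        NumberField.IsTotallyReal ↥(IntermediateField.fixedField H) ∧
        Module.finrank ℚ ↥(IntermediateField.fixedField H) = orderOf χ ∧
        ∀ χ' : DirichletCharacter ℂ m,
          (∀ σ ∈ H, ∀ a : ℕ, (∀ z : CyclotomicField m ℚ, z ^ m = 1 → σ z = z ^ a) →
            χ' (a : ZMod m) = 1) → ∃ j : ℕ, χ' = χ ^ j := by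
  intro m _ χ hχ
  haveI : IsCyclotomicExtension {m} ℚ (CyclotomicField m ℚ) :=
    CyclotomicField.isCyclotomicExtension m ℚ
  exact cycloGlue_of_isCyclotomicExtension (CyclotomicField m ℚ) χ hχ

end Summit.BirchSwinnertonDyer.BirchSwinnertonDyer.Theorems

end
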